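import Literature.AlgebraicGeometry.Motives.ProjectiveBundleOfQuotientTrivialisation
import Literature.AlgebraicGeometry.Modules.KernelOfEpiHasRank
import Literature.AlgebraicGeometry.Modules.VanishingLocusFiniteLocallyFree
import Literature.AlgebraicGeometry.KTheory.GrothendieckGroup
import Literature.AlgebraicGeometry.Modules.FrameTransition
import HarnessLib

/-!
# Splitting data of `𝒪^J ↠ G` from a frame over an affine open; local triviality `P(G)|_U ≅ U × Gr₁(M')`

Topic `AlgebraicGeometry/Motives`; namespace `Literature.AlgebraicGeometry.Motives.Grassmannian.ProjBundle`. THEOREMS ONLY (no definition,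
no instance, no notation, no named fact, no `sorry`).

Completes the local triviality of the incidence model `P(G) → X` ([Hartshorne1977, II §7 Prop. 7.11]; ★
`Motives/ProjectiveBundleOfQuotientTrivialisation.trivialisationIso`, which takes SPLITTING DATA of `φ|_U`): over an AFFINE open `U ⊆ X`
carrying a frame `e : 𝒪_U^{J'} ≅ G|_U`, the splitting data exist (`exists_splittingData`) — `S` = the matrix of `φ|_U : 𝒪^J → G ≅ 𝒪^{J'}`
in the frame, `R` = coordinates of preimages of the frame sections under the SURJECTION `φ_U : Γ(𝒪^J, U) ↠ Γ(G, U)` (`U` affine,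
★ `app_surjective_of_epi`), the relations `k_l` = kernel sections with coordinates the columns of `1 - R S` (sections of `ker φ` are the
kernel of `φ_U`, ★ `exists_kernel_ι_app_eq`). Hence **`exists_trivialisationIso`**: an isomorphism `↑(proj⁻¹U) ≅ ↑U ⨯ Gr₁(M')` over `U`
for every affine open `U` over which `G` is free of rank `|J'|` and every free `ℤ`-module `M'` with basis indexed by `J'`.

* §1 two coordinate lemmas on top of ★ `Modules/FrameTransition` (`coord_sum_smul`, `coord_id_sum_smul_basisSection`);
* §2 `exists_splittingData`; §3 `exists_trivialisationIso`.

## References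
* [Hartshorne1977] R. Hartshorne, *Algebraic Geometry* (1977), II §7 Prop. 7.11; II §5 (frames, p. 109).
* [GortzWedhorn2020] U. Görtz, T. Wedhorn, *Algebraic Geometry I*, 2nd ed. (2020), (13.8), (8.4).
-/

set_option autoImplicit false

noncomputable section

set_option backward.isDefEq.respectTransparency false

open CategoryTheory CategoryTheory.Limits Opposite TopologicalSpace AlgebraicGeometry TensorProduct Matrix
open Literature.AlgebraicGeometry.Modules

namespace Literature.AlgebraicGeometry.Motives.Grassmannian

namespace ProjBundle

/-! ## §1 Coordinate calculus in a frame (★ `Modules/FrameTransition`: `coord_zero/smul/sum/map`, `coord_sum_smul_basisSection`) -/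

section Coord

variable {X : Scheme.{0}} {E : X.Modules} {W V : X.Opens} {I : Type} (e : SheafOfModules.free I ≅ E.over W)

/-- `λ_i(Σ_j r_j • s_j) = Σ_j r_j λ_i(s_j)`. [cite: Hartshorne1977, II §5 (p. 109)] -/
theorem coord_sum_smul {ι : Type} (t : Finset ι) (k : V ⟶ W) (r : ι → Γ(X, V)) (s : ι → Γ(E, V)) (i : I) :
    coord e k (∑ j ∈ t, r j • s j) i = ∑ j ∈ t, r j * coord e k (s j) i := by
  rw [coord_sum]
  simp only [coord_smul]

/-- Coordinates of a combination of the frame sections themselves (`k = 𝟙`): `λ_i(Σ_j c_j b_j) = c_i`.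
[cite: Hartshorne1977, II §5 (p. 109)] -/
theorem coord_id_sum_smul_basisSection [Fintype I] (c : I → Γ(X, W)) (i : I) :
    coord e (𝟙 W) (∑ j, c j • basisSection e j) i = c i := by
  have h := coord_sum_smul_basisSection e (𝟙 W) c i
  simp only [op_id, E.presheaf.map_id] at h
  exact h

end Coord

/-! ## §2 Splitting data from a frame over an affine open -/

variable {X : Scheme.{0}} (M : Type) [AddCommGroup M] {J : Type} [Fintype J] [DecidableEq J] (b : Module.Basis J ℤ M)
  [(grassmannianSheaf M 1).obj.IsRepresentable] {G : X.Modules} (φ : freeModule X J ⟶ G) [Epi φ] (hG : IsFiniteLocallyFree G)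
  (M' : Type) [AddCommGroup M'] {J' : Type} [Fintype J'] [DecidableEq J'] (b' : Module.Basis J' ℤ M')
  [(grassmannianSheaf M' 1).obj.IsRepresentable] {U : X.Opens} (hU : IsAffineOpen U)

omit [DecidableEq J] [Epi φ] in
/-- `φ_V(Σ_j c_j ε_j|_V) = Σ_j c_j φ(ε_j)|_V`. [cite: Hartshorne1977, II §5 (p. 109)] -/
theorem app_sum_smul_freeSectionOn {V : X.Opens} (c : J → Γ(X, V)) :
    φ.app V (∑ j, c j • freeSectionOn X j V) = ∑ j, c j • φ.app V (freeSectionOn X j V) := by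
  rw [map_sum]
  exact Finset.sum_congr rfl fun j _ => Scheme.Modules.Hom.app_smul φ (c j) _

omit [DecidableEq J] in
/-- Expansion of a section of `𝒪^J` over `V` in the tautological frame: `s = Σ_j a_j(s) ε_j|_V` with
`a_j = coord (freeModuleFrame V) (𝟙 V) s j`. [cite: Hartshorne1977, II §5 (p. 109)] -/
theorem eq_sum_coord_smul_freeSectionOn {V : X.Opens} (s : Γ(freeModule X J, V)) :
    s = ∑ j, coord (freeModuleFrame X J V) (𝟙 V) s j • freeSectionOn X j V := by
  have h := eq_sum_coord_smul (freeModuleFrame X J V) (𝟙 V) s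
  simp only [op_id, (freeModule X J).presheaf.map_id, basisSection_freeModuleFrame] at h
  exact h

include hG hU in
/-- **SPLITTING DATA OF `φ|_U` FROM A FRAME** over an affine open `U`: matrices `S` (of `φ|_U` in the frame), `R` (coordinates of
`φ_U`-preimages of the frame sections) with `S R = 1`, `S` killing the coordinates of all relations, and kernel sections `k_l` with
coordinates the columns of `1 - R S`. [cite: Hartshorne1977, II §7 Prop. 7.11] [cite: GortzWedhorn2020, (13.8)] -/
theorem exists_splittingData (e : SheafOfModules.free J' ≅ G.over U) :
    ∃ (S : Matrix J' J Γ(X, U)) (R : Matrix J J' Γ(X, U)) (k : J → Γ(kernel φ, U)), S * R = 1 ∧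
      (∀ (W : X.Opens) (s : Γ(kernel φ, W)) (i : J'),
        ∑ j, X.presheaf.map (homOfLE (inf_le_right : W ⊓ U ≤ U)).op (S i j) *
          X.presheaf.map (homOfLE (inf_le_left : W ⊓ U ≤ W)).op
            (coord (freeModuleFrame X J W) (𝟙 W) ((kernel.ι φ).app W s) j) = 0) ∧
      ∀ j l, coord (freeModuleFrame X J U) (𝟙 U) ((kernel.ι φ).app U (k l)) j = ((1 : Matrix J J Γ(X, U)) - R * S) j l := by
  -- the matrix of `φ|_U` in the frame
  set S : Matrix J' J Γ(X, U) := fun i j => coord e (𝟙 U) (φ.app U (freeSectionOn X j U)) i with hSdef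
  have hφε : ∀ j, φ.app U (freeSectionOn X j U) = ∑ i, S i j • basisSection e i := fun j => by
    have h := eq_sum_coord_smul e (𝟙 U) (φ.app U (freeSectionOn X j U))
    simp only [op_id, G.presheaf.map_id] at h
    exact h
  -- preimages of the frame sections under the surjection `φ_U`
  have hsurj : Function.Surjective (φ.app U) :=
    Morphisms.app_surjective_of_epi φ (isAffineLocalizing_of_isFiniteLocallyFree (Literature.AlgebraicGeometry.KTheory.KZero.isFiniteLocallyFree_free J))
      (isAffineLocalizing_of_isFiniteLocallyFree hG) hU
  choose p hp using fun i => hsurj (basisSection e i)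
  set R : Matrix J J' Γ(X, U) := fun j i => coord (freeModuleFrame X J U) (𝟙 U) (p i) j with hRdef
  -- `S R = 1`
  have hSR : S * R = 1 := by
    ext i i'
    have h := hp i'
    rw [eq_sum_coord_smul_freeSectionOn (p i'), app_sum_smul_freeSectionOn] at h
    have h' := congrArg (fun s => coord e (𝟙 U) s i) h
    simp only [coord_sum_smul, coord_basisSection] at h'
    rw [Matrix.mul_apply, Matrix.one_apply]
    by_cases hii : i = i'
    · subst hii
      rw [if_pos rfl] at h' ⊢
      rw [← h']
      exact Finset.sum_congr rfl fun j _ => mul_comm _ _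
    · rw [if_neg hii]
      rw [if_neg (Ne.symm hii)] at h'
      rw [← h']
      exact Finset.sum_congr rfl fun j _ => mul_comm _ _
  -- the relations `k_l`
  have hv : ∀ l, φ.app U (∑ j, ((1 : Matrix J J Γ(X, U)) - R * S) j l • freeSectionOn X j U) = 0 := fun l => by
    rw [app_sum_smul_freeSectionOn]
    simp_rw [hφε, Finset.smul_sum, smul_smul]
    rw [Finset.sum_comm]
    refine Finset.sum_eq_zero fun i _ => ?_
    rw [← Finset.sum_smul]
    have h0 : ∑ j, ((1 : Matrix J J Γ(X, U)) - R * S) j l * S i j = (S * ((1 : Matrix J J Γ(X, U)) - R * S)) i l := by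
      rw [Matrix.mul_apply]
      exact Finset.sum_congr rfl fun j _ => mul_comm _ _
    rw [h0, mul_one_sub_mul_eq_zero hSR, Matrix.zero_apply, zero_smul]
  choose k hk using fun l => exists_kernel_ι_app_eq φ U _ (hv l)
  refine ⟨S, R, k, hSR, fun W s i => ?_, fun j l => ?_⟩
  · -- `S` kills the coordinates of the relations
    set a : J → Γ(X, W) := fun j => coord (freeModuleFrame X J W) (𝟙 W) ((kernel.ι φ).app W s) j with hadef
    have hκ : (kernel.ι φ).app W s = ∑ j, a j • freeSectionOn X j W := eq_sum_coord_smul_freeSectionOn _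
    have h0 : φ.app W ((kernel.ι φ).app W s) = 0 := app_kernel_ι_app φ W s
    rw [hκ, app_sum_smul_freeSectionOn] at h0
    -- restrict to `W ⊓ U`
    have h1 := congrArg (G.presheaf.map (homOfLE (inf_le_left : W ⊓ U ≤ W)).op) h0
    rw [map_zero, map_sum] at h1
    have hres : ∀ j, G.presheaf.map (homOfLE (inf_le_left : W ⊓ U ≤ W)).op (φ.app W (freeSectionOn X j W)) =
        ∑ i, X.presheaf.map (homOfLE (inf_le_right : W ⊓ U ≤ U)).op (S i j) •
          G.presheaf.map (homOfLE (inf_le_right : W ⊓ U ≤ U)).op (basisSection e i) := fun j => by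
      rw [← app_presheaf_map, map_freeSectionOn, ← map_freeSectionOn (homOfLE (inf_le_right : W ⊓ U ≤ U)) j,
        app_presheaf_map, hφε, map_sum]
      exact Finset.sum_congr rfl fun i _ => Scheme.Modules.map_smul G _ _ _
    have h1 := congrArg (G.presheaf.map (homOfLE (inf_le_left : W ⊓ U ≤ W)).op) h0
    rw [map_zero, map_sum] at h1
    simp only [Scheme.Modules.map_smul, hres] at h1
    have h2 := congrArg (fun t => coord e (homOfLE (inf_le_right : W ⊓ U ≤ U)) t i) h1
    simp only [coord_zero] at h2
    rw [coord_sum_smul] at h2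
    simp only [coord_sum_smul_basisSection] at h2
    rw [← h2]
    exact Finset.sum_congr rfl fun j _ => mul_comm _ _
  · rw [hk]
    simp_rw [← basisSection_freeModuleFrame]
    exact coord_id_sum_smul_basisSection (freeModuleFrame X J U) _ j

/-! ## §3 Local triviality over affine opens trivialising `G` -/

include b' hG hU in
/-- **LOCAL TRIVIALITY `P(G)|_U ≅ U × Gr₁(M')`** over an affine open `U` carrying a frame `𝒪_U^{J'} ≅ G|_U`, for any free
`ℤ`-module `M'` with basis indexed by `J'`; the isomorphism commutes with the projections to `U`.
[cite: Hartshorne1977, II §7 Prop. 7.11] [cite: GortzWedhorn2020, (13.8)] -/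
theorem exists_trivialisationIso (e : SheafOfModules.free J' ≅ G.over U) :
    ∃ t : (((proj M b φ) ⁻¹ᵁ U : (total M b φ).Opens) : Scheme.{0}) ≅ (U : Scheme.{0}) ⨯ grassmannianScheme M' 1,
      t.hom ≫ prod.fst = (proj M b φ) ∣_ U := by
  obtain ⟨S, R, k, hSR, hS, hk⟩ := exists_splittingData φ hG hU e
  exact ⟨trivialisationIso M b φ M' b' U hG S R hSR hS k hk, trivialisationIso_hom_fst M b φ M' b' U hG S R hSR hS k hk⟩

end ProjBundle


end Literature.AlgebraicGeometry.Motives.Grassmannian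

end
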